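import Literature.Claims.NS.Iotti2025
import Literature.Analysis.FluidPDE.H1ContinuationSobolevClass
import Mathlib.MeasureTheory.Integral.IntervalIntegral.Basic
import Mathlib.MeasureTheory.Integral.IntervalIntegral.FundThmCalculus
import Mathlib.Analysis.Calculus.MeanValue
import Mathlib.Analysis.SpecialFunctions.ExpDeriv
import HarnessLib

/-!
# Claim skeleton (QUICK, Constraint grain): T. Pan & Y. Pan (2025), «Study on the Global Smoothness of
# Solutions to the Navier-Stokes Equations» (SSRN 5355152 = Zenodo 16471728)

Cell `ns-claims` (D-0090 NS-CLAIMS SWEEP), claim **C97** (T3 row un-parked by RULINGS v1.29s (2): «QUICK-at-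
STATEMENT / Constraint grain»), typist `ns-claims-typist-10` (g2); lanes ref-1 g2 · salvage-p6 · acting
writer-2 (odd row); sources lit-1 g6: `pub/ns-claims/sources/PanPan2025/` (LOCATORS.md, `Zenodo-16471728/pages`,
`renders/p001–p069.png`; bib `PanPan2025`). UNREFEREED CLAIM under adjudication — NOTHING in this file asserts a
step: every `Step_…`/Constraint is a `Prop`; the only `theorem`s are the kernel composition of the paper's own
implications and the Clay link. Version of record: Zenodo 16471728 (file «20250719.pdf», 2025-07-17, only
version; 69 pp.; PDF page = printed page; «p.27 d8» = 8th display of page 27; symbols read on the renders).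

## Claimed statement (as printed)

Abstract p.2: «… it rigorously proves that under the constraints of initial data in H³(ℝ³), non-zero viscosity
coefficient, and regular external force fields, strong solutions do not exhibit finite-time blowup, can be
extended to the entire time axis, and maintain global smoothness.» Theorem 3.1.4 p.25 («Let u₀ ∈ H^k(ℝ³) for
k > 5/2. Then the following are equivalent: (i) The strong solution exists on [0,∞). (ii) The intrinsic
configuration in Definition 3.1.1 holds for all T > 0») together with Theorem 3.1.2 p.24 («Rigidity … If a
strong solution exists on [0,T), then it necessarily satisfies all constraints in Definition 3.1.1») and Ch. Ⅳ
(«Proof of the non-occurrence of finite-time blow-up for strong solutions», pp.37–47). Typed as `ClaimedTheorem`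
(UNFORCED instance `f ≡ 0`, which is all the Clay link needs — TODO(general form): «regular external force»).

## Rendering

«Strong solution u ∈ C([0,T*); H^k) ∩ L²([0,T*); H^{k+1})» (p.38) with H³/H^k data is rendered in the cell's
Beale–Kato–Majda convention REUSED BY NAME from C17 (`Chae2007.IsDatum`, `IsLocalSolution ν T v₀ u p`,
`IsGlobalSolution`, `BlowsUpAt T u` = the squared `H³` norm is unbounded on `[0,T)` — p.38/p.40 «lim_{t↗T*}
‖u(t)‖_{H³} = ∞»), exactly as C28b `Iotti2025` does (imported); `‖∇u(t)‖²_{L²}` is the tree's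
`VectorCalculus.gradNormSq (u t)` (Frobenius norm of `Du`), `‖w‖²_{L²}` is `l2Sq w`. TODO(general form): `H^k`
data, `k > 5/2`; the class used is an instance (weaker than print — a kernel refutation refutes the print).

## Clay delta (reference `ClayVariants.lean`, Δ-axes §3)

Nearest: (A) `clayR3.Regularity`; Δ1 ℝ³ with decay at infinity (Def. 3.1.1) = · Δ3 «regular external force
fields» ⊇ {0} (stronger; instance typed) · Δ4 data H³(ℝ³) / H^k, k > 5/2 ⊋ Clay (4) (stronger) · Δ5 strong
solutions continued globally; smoothness and (7) follow in the class · Δ7 every ν > 0 =. `clay_of_claimed :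
ClaimedTheorem → clayR3.Regularity` PROVED (it is C28b's `Iotti2025.clay_of_claimedGlobalNS`: the two headlines
have the same (A)-shaped rendering, `claimedTheorem_iff_C28b`). Δ2 rider, OFF the strict path by the author's
own Remark 4.1.2 p.39 («The physical conflict outlined above serves only for intuitive illustration»):
Constraint 4 «Cross-Scale Physical Compatibility» (Knudsen bound `ν/(ℓ v_th) ≥ K₀` «∀ ℓ > 0» and the viscous
power bound `(1/ρ)|∫(νΔu)·u| ≤ P_max` «from molecular kinetic theory», p.24) — typed as `Constraint4` and
recorded, not consumed by `claim_of_steps`.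

## ORDERED STEP INDEX (dependency order = the order `claim_of_steps` consumes them)

* Step 1 = `Step_1` · Thm 2.1 p.16 / «By the local existence theorem (Kato, 1972), the solution extends to some
  maximal time T* > 0» (proof of Thm 3.1.4 p.25) · local theory with a maximal solution: GLOBAL ∨ finite `T*`
  with blow-up — BY NAME `Chae2007.Step_1` (classical).
* Step 2 = `Step_C1` · **Theorem 3.1.2 (Rigidity) p.24 restricted to Constraint 1 = §3.2.1 (21) p.28** («By
  standard Gronwall's inequality … it follows that y(t) + ν∫₀ᵗ‖Δu(s)‖²_{L²}ds ≤ C», y(t) = ‖∇u(t)‖²_{L²};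
  «‖∇u‖_{L^∞(0,T;L²)} ≤ C» (p.28 d2)): every strong solution on `[0,T)` has `‖∇u(t)‖²_{L²}` bounded on `[0,T)`.
  Its printed derivation (17)→(21) pp.27–28 has two load-bearing displays, typed as companions (FAILURE-MODES
  F15): `Step_C1a` = p.27 d8 «‖∇((u·∇)u)‖_{L²} ≤ C‖u‖_{L⁶}‖∇u‖_{L³} ≤ C‖∇u‖_{L²}‖∇u‖_{L³}» (a functional
  inequality with a universal constant) and `Step_C1bAbs` = p.28 l.1–4, the Grönwall step read at the grain the
  print invokes it («standard Gronwall's inequality (cf. Evans, 2010, Appendix B)» applied to the differential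
  inequality p.27 d11 `½y′ + ν‖Δu‖² ≤ ½‖∇f‖² + ½y + (C²/4ε)y² + ε‖∇u‖²_{L³}`, i.e. to `y′ ≤ a + b·y + c·y²`):
  a nonnegative function with `y′ ≤ a + by + cy²` on `[0,T]` is bounded on `[0,T]` by a constant depending on
  `y(0), a, b, c, T`. No glue `Step_C1bAbs → Step_C1` is proved (the reduction is the printed chain itself).
* Step 3 = `Step_IV` · Ch. Ⅳ §4.2 pp.40–43 as an implication («Step 1: Blowup necessarily induces divergence of
  the velocity gradient norm» p.40; «Step 2: Contradiction with the Axiom of Energy Conservation» p.42–43): a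
  solution of the class on `[0,T)` obeying Constraint 1 does not blow up at `T` (classical for `ν > 0` as an
  implication; the PRINTED route to it contains `Step_IV2c` = p.43 «For δ > 0, the right-hand side satisfies 2Mδ
  > M (since |I_δ| = δ > 0)» and `Step_IV2Abs` = p.43 «limsup_{t→T*}‖∇u(t)‖_{L²} = +∞ … ν∫₀^{T*}‖∇u(s)‖²ds >
  M», read at F15 grain: an unbounded nonnegative integrand forces an unbounded integral — both recorded, typed,
  not consumed).
* `claim_of_steps : Step_1 → Step_C1 → Step_IV → ClaimedTheorem` PROVED (proof of Thm 3.1.4 (ii)⟹(i) p.25: «The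
  global boundedness provided by the intrinsic configuration prevents blowup at T*»).
* Recorded: `Constraint1 … Constraint4`, `IntrinsicConfiguration` (Definition 3.1.1 p.23–24), `Step_Rigidity` (Thm
  3.1.2 in full), `Step_C1a`, `Step_C1bAbs`, `Step_IV2Abs`, `Step_IV2c`.

Cell record (CARD `pub/ns-claims/claims/PanPan2025/CARD.md` §4, PREDICTED 2026-08-27T02:18Z before the body was
read): expected first failing step = §3.2.1 Constraint 1 pp.26–28 (the upgrade of the energy identity to a
global H¹ bound). Adjudicated by the refuter/referee, not here.

**rev 2 (ADDITIVE, HYGIENE 13 — both grains recorded):** REF C97 (ns-claims-ref-1 g2, PRE-READ 2026-08-27T02:37:24Z,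
`claims/PanPan2025/RETYPE.md` §2) reads p.28 l.1–2 «utilize the kinetic energy estimate» as putting the dissipation
bound of (16) p.27, `∫₀ᵀ y ≤ K`, in hand at the Grönwall step; that charitable face is typed as `Step_C1bK` and
PROVED (`step_C1bK_holds`: with `β = b + c·y ∈ L¹`, `y(t) ≤ (y(0) + aT)·e^{bT + cK}`), so under the referee's
reading p.28 closes and the printed derivation of Constraint 1 rests on p.27 d8 (`Step_C1a`) alone; `Step_C1bAbs`
(p.28 read without (16)) stays as typed.

WHAT THIS IS NOT: not a claim about NS regularity or blow-up; not a claim about any author beyond the typed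
locator.
-/

noncomputable section

open Set Function Filter MeasureTheory intervalIntegral
open scoped Topology ENNReal NNReal ContDiff Laplacian InnerProductSpace

namespace Literature.Claims.NS.PanPan2025

open Literature.Analysis.FluidPDE
open Literature.Claims.NS.Chae2007 (IsDatum IsLocalSolution IsGlobalSolution BlowsUpAt)

/-! ### Vocabulary (definitions with bodies; nothing asserted) -/

/-- `‖w‖²_{L²(ℝ³)} = ∫|w|²` (p.24, p.27; Bochner integral, junk `0` if not integrable — fields of the class are
square integrable). [cite: PanPan2025, Def. 3.1.1 p.24] -/
def l2Sq (w : EuclideanSpace ℝ (Fin 3) → EuclideanSpace ℝ (Fin 3)) : ℝ :=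
  ∫ x, ‖w x‖ ^ 2

/-- The squared `H^k` norm `Σ_{n ≤ k} ∫ ‖Dⁿw‖²` as an extended real (no junk), the quantity of «sup_{t∈[0,T)}
‖u(·,t)‖_{H^k} ≤ C_H(T)» (p.24) and of the blow-up hypothesis p.38. [cite: PanPan2025, Def. 3.1.1 p.24] -/
def hkSqE (k : ℕ) (w : EuclideanSpace ℝ (Fin 3) → EuclideanSpace ℝ (Fin 3)) : ℝ≥0∞ :=
  ∑ n ∈ Finset.range (k + 1), ∫⁻ x, ‖iteratedFDeriv ℝ n w x‖ₑ ^ 2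

/-! ### Definition 3.1.1 (Intrinsic Configuration, pp.23–24) for a solution `(u,p)` on `ℝ³ × [0,T)` -/

/-- **(1) Derivative Boundedness — Low-Order Regularity (p.24 d1)**: «∃C_L > 0 such that sup_{t∈[0,T)}
‖u(·,t)‖_{L²} + ∫₀ᵀ‖∇u(·,t)‖²_{L²}dt ≤ C_L», rendered on every `[0,τ]`, `τ < T`.
[cite: PanPan2025, Def. 3.1.1 (1) p.24] -/
def Constraint1Low (T : ℝ) (u : ℝ → EuclideanSpace ℝ (Fin 3) → EuclideanSpace ℝ (Fin 3)) : Prop :=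
  ∃ C : ℝ, ∀ τ ∈ Ico 0 T, Real.sqrt (l2Sq (u τ)) + ∫ s in (0:ℝ)..τ, VectorCalculus.gradNormSq (u s) ≤ C

/-- **(1) Derivative Boundedness — High-Order Regularity (p.24 d2)**: «∃k ≥ 2 and C_H(T) > 0 such that
sup_{t∈[0,T)} ‖u(·,t)‖_{H^k} ≤ C_H(T)». [cite: PanPan2025, Def. 3.1.1 (1) p.24] -/
def Constraint1High (T : ℝ) (u : ℝ → EuclideanSpace ℝ (Fin 3) → EuclideanSpace ℝ (Fin 3)) : Prop :=
  ∃ k : ℕ, 2 ≤ k ∧ ∃ C : ℝ≥0, ∀ t ∈ Ico 0 T, hkSqE k (u t) ≤ (C : ℝ≥0∞)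

/-- **Constraint 1 as DERIVED, §3.2.1 (21) and d2 of p.28: «y(t) + ν∫₀ᵗ‖Δu(s)‖²_{L²}ds ≤ C», «‖∇u‖_{L^∞(0,T;L²)}
≤ C»** — the global boundedness of the velocity gradient in `L²` on `[0,T)`.
[cite: PanPan2025, §3.2.1 (21) p.28] -/
def Constraint1H1 (ν T : ℝ) (u : ℝ → EuclideanSpace ℝ (Fin 3) → EuclideanSpace ℝ (Fin 3)) : Prop :=
  ∃ C : ℝ, ∀ t ∈ Ico 0 T,
    VectorCalculus.gradNormSq (u t) + ν * ∫ s in (0:ℝ)..t, l2Sq (fun x => Δ (u s) x) ≤ C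

/-- **(2) Pressure Regularity Constraint (p.24 d3)**: «sup_t ‖p(·,t)‖_{W^{k−1,∞}} ≤ C_P sup_t ‖u·∇u‖_{W^{k−1,∞}}»
— rendered at `k − 1 = 0`: the pressure is bounded by a multiple of the sup of `|u·∇u|`, on `[0,T)`.
TODO(general form): `W^{k−1,∞}`. [cite: PanPan2025, Def. 3.1.1 (2) p.24] -/
def Constraint2 (T : ℝ) (u : ℝ → EuclideanSpace ℝ (Fin 3) → EuclideanSpace ℝ (Fin 3))
    (p : ℝ → EuclideanSpace ℝ (Fin 3) → ℝ) : Prop :=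
  ∃ C : ℝ, ∀ B : ℝ, (∀ t ∈ Ico 0 T, ∀ x, ‖convect (u t) (u t) x‖ ≤ B) → ∀ t ∈ Ico 0 T, ∀ x, |p t x| ≤ C * B

/-- **(3) Energy Non-Blowup Constraints (p.24 d4–d5)**: «½ d/dt‖u‖²_{L²} = −ν‖∇u‖²_{L²} ≤ 0» and «∫₀ᵀ‖∇u‖²dt <
∞», rendered: the kinetic energy is non-increasing on `[0,T)` and the dissipation integrals `∫₀^τ`, `τ < T`,
are bounded. [cite: PanPan2025, Def. 3.1.1 (3) p.24] -/
def Constraint3 (T : ℝ) (u : ℝ → EuclideanSpace ℝ (Fin 3) → EuclideanSpace ℝ (Fin 3)) : Prop :=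
  (∀ s ∈ Ico 0 T, ∀ t ∈ Ico 0 T, s ≤ t → l2Sq (u t) ≤ l2Sq (u s)) ∧
    ∃ D : ℝ, ∀ τ ∈ Ico 0 T, ∫ s in (0:ℝ)..τ, VectorCalculus.gradNormSq (u s) ≤ D

/-- **(4) Cross-Scale Physical Compatibility (p.24 d6–d7)**: «∃K₀ > 0, ∃v_th > 0 such that ∀t ∈ [0,T) and ∀ℓ > 0
(characteristic length scale), ν/(ℓ v_th) ≥ K₀ (Knudsen number bound) and (1/ρ)|∫(νΔu)·u dx| ≤ P_max (Viscous
force power bound) where P_max is the physical upper limit derived from molecular kinetic theory» — typed AS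
PRINTED with `ρ`, `P_max` as parameters (note the printed quantifier «∀ ℓ > 0»). The author's Remark 4.1.2 p.39
puts this constraint off the strict path. [cite: PanPan2025, Def. 3.1.1 (4) p.24] -/
def Constraint4 (ρ Pmax ν T : ℝ) (u : ℝ → EuclideanSpace ℝ (Fin 3) → EuclideanSpace ℝ (Fin 3)) : Prop :=
  ∃ K₀ : ℝ, 0 < K₀ ∧ ∃ vth : ℝ, 0 < vth ∧ ∀ t ∈ Ico 0 T, ∀ ℓ : ℝ, 0 < ℓ →
    K₀ ≤ ν / (ℓ * vth) ∧ (1 / ρ) * |∫ x, ⟪ν • Δ (u t) x, u t x⟫_ℝ| ≤ Pmax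

/-- **Definition 3.1.1 in full** («the collection of structural constraints that the solution must satisfy»).
[cite: PanPan2025, Def. 3.1.1 pp.23–24] -/
def IntrinsicConfiguration (ρ Pmax ν T : ℝ) (u : ℝ → EuclideanSpace ℝ (Fin 3) → EuclideanSpace ℝ (Fin 3))
    (p : ℝ → EuclideanSpace ℝ (Fin 3) → ℝ) : Prop :=
  Constraint1Low T u ∧ Constraint1High T u ∧ Constraint2 T u p ∧ Constraint3 T u ∧ Constraint4 ρ Pmax ν T u

/-! ### The claimed statement -/

/-- **Abstract p.2 / Theorem 3.1.4 (i) p.25 / Ch. Ⅳ: every strong solution extends to `[0,∞)`** — rendered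
(unforced instance, BKM class): for every `ν > 0` and every datum of the class there is a global solution of the
class. [claim: PanPan2025, status: disputed] -/
def ClaimedTheorem : Prop :=
  ∀ ν : ℝ, 0 < ν → ∀ v₀ : EuclideanSpace ℝ (Fin 3) → EuclideanSpace ℝ (Fin 3), IsDatum v₀ →
    ∃ (u : ℝ → EuclideanSpace ℝ (Fin 3) → EuclideanSpace ℝ (Fin 3)) (p : ℝ → EuclideanSpace ℝ (Fin 3) → ℝ),
      IsGlobalSolution ν v₀ u p

/-- The headline has the same (A)-shaped rendering as C28b's «extended for all t ≥ 0» (definitional).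
[cite: PanPan2025, Thm 3.1.4 p.25] -/
theorem claimedTheorem_iff_C28b : ClaimedTheorem ↔ Iotti2025.ClaimedGlobalNS :=
  Iff.rfl

/-! ### The paper's steps (no assertion) -/

/-- **Step 1 — local theory with a maximal solution** (Thm 2.1 p.16; proof of Thm 3.1.4 p.25 «By the local
existence theorem (Kato, 1972), the solution extends to some maximal time T* > 0»; Assumption 4.1.1 p.38):
GLOBAL solution ∨ finite `T*` with a solution on `[0,T*)` that blows up (in `H³`) at `T*` — BY NAME the cell's
`Chae2007.Step_1` (classical). [cite: PanPan2025, Thm 2.1 p.16; proof of Thm 3.1.4 p.25] -/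
def Step_1 : Prop :=
  Chae2007.Step_1

/-- **Step 2 = Step_C1 — Theorem 3.1.2 (Rigidity, p.24) ⊇ Constraint 1 as derived in §3.2.1, (21) p.28: «By
standard Gronwall's inequality (cf. Evans, 2010, Appendix B) and the initial condition y(0) = ‖∇u₀‖²_{L²}, it
follows that: y(t) + ν∫₀ᵗ‖Δu(s)‖²_{L²}ds ≤ C», «‖∇u‖_{L^∞(0,T;L²)} ≤ C»** — for EVERY solution of the class on
`[0,T)`, every `ν > 0`. (The a-priori `H¹` bound.) [claim: PanPan2025, status: disputed] -/
def Step_C1 : Prop :=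
  ∀ ν : ℝ, 0 < ν → ∀ T : ℝ, 0 < T →
    ∀ (v₀ : EuclideanSpace ℝ (Fin 3) → EuclideanSpace ℝ (Fin 3))
      (u : ℝ → EuclideanSpace ℝ (Fin 3) → EuclideanSpace ℝ (Fin 3)) (p : ℝ → EuclideanSpace ℝ (Fin 3) → ℝ),
      IsLocalSolution ν T v₀ u p → Constraint1H1 ν T u

/-- **Step_C1a — p.27 d8 «Utilizing the three-dimensional Sobolev embedding H¹ ↪ L⁶ and Hölder's inequality:
‖∇((u·∇)u)‖_{L²} ≤ C‖u‖_{L⁶}‖∇u‖_{L³} ≤ C‖∇u‖_{L²}‖∇u‖_{L³}»**, first inequality, read as the functional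
inequality it states: one constant `C` for all smooth compactly supported divergence-free fields `v`.
[claim: PanPan2025, status: disputed] -/
def Step_C1a : Prop :=
  ∃ C : ℝ, ∀ v : EuclideanSpace ℝ (Fin 3) → EuclideanSpace ℝ (Fin 3),
    ContDiff ℝ ∞ v → HasCompactSupport v → VectorCalculus.IsDivFree v →
    Real.sqrt (l2Sq (fun x => fderiv ℝ (convect v v) x (EuclideanSpace.single 0 1)) +
        l2Sq (fun x => fderiv ℝ (convect v v) x (EuclideanSpace.single 1 1)) +
        l2Sq (fun x => fderiv ℝ (convect v v) x (EuclideanSpace.single 2 1))) ≤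
      C * (∫ x, ‖v x‖ ^ 6) ^ ((1:ℝ) / 6) * (∫ x, (frobeniusNormSq (fderiv ℝ v x)) ^ ((3:ℝ) / 2)) ^ ((1:ℝ) / 3)

/-- **Step_C1bAbs — the Grönwall step p.28 l.1–4 at the grain the print invokes it (FAILURE-MODES F15)**: «To
apply Gronwall's inequality, define y(t) := ‖∇u(t)‖²_{L²} … By standard Gronwall's inequality (cf. Evans, 2010,
Appendix B) and the initial condition y(0) = ‖∇u₀‖²_{L²}, it follows that y(t) + ν∫₀ᵗ‖Δu(s)‖²ds ≤ C», applied to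
the differential inequality p.27 d11 `½y′ + ν‖Δu‖² ≤ ½‖∇f‖² + ½y + (C²/4ε)y² + ε‖∇u‖²_{L³}` (after the
interpolation p.28 l.2, of the form `y′ ≤ a + b y + c y²`): for all constants `a, b, c ≥ 0`, every `T > 0` and
every initial value `y₀ ≥ 0` there is `M` such that every nonnegative differentiable `y` on `[0,T]` with `y(0) =
y₀` and `y′ ≤ a + b y + c y²` on `[0,T]` satisfies `y ≤ M` on `[0,T]`. [claim: PanPan2025, status: disputed] -/
def Step_C1bAbs : Prop :=
  ∀ a b c : ℝ, 0 ≤ a → 0 ≤ b → 0 ≤ c → ∀ T : ℝ, 0 < T → ∀ y₀ : ℝ, 0 ≤ y₀ →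
    ∃ M : ℝ, ∀ y : ℝ → ℝ, y 0 = y₀ → (∀ t ∈ Icc 0 T, 0 ≤ y t) →
      (∀ t ∈ Icc 0 T, ∃ y' : ℝ, HasDerivAt y y' t ∧ y' ≤ a + b * y t + c * y t ^ 2) →
      ∀ t ∈ Icc 0 T, y t ≤ M

/-- **Step 3 = Step_IV — Ch. Ⅳ §4.2 pp.40–43 as an implication** («Step 1: Blowup Necessarily Induces Divergence
of the Velocity Gradient Norm», «Step 2: Contradiction with the Axiom of Energy Conservation … thereby
invalidating the blowup hypothesis»): a solution of the class on `[0,T)` that obeys Constraint 1 (the `H¹` bound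
(21)) does not blow up at `T`, every `ν > 0`. (True classically — `L^∞_t H¹_x` is a continuation class for
Navier–Stokes; the PRINTED route is `Step_IV2Abs` + `Step_IV2c` below.) [claim: PanPan2025, status: disputed] -/
def Step_IV : Prop :=
  ∀ ν : ℝ, 0 < ν → ∀ T : ℝ, 0 < T →
    ∀ (v₀ : EuclideanSpace ℝ (Fin 3) → EuclideanSpace ℝ (Fin 3))
      (u : ℝ → EuclideanSpace ℝ (Fin 3) → EuclideanSpace ℝ (Fin 3)) (p : ℝ → EuclideanSpace ℝ (Fin 3) → ℝ),
      IsLocalSolution ν T v₀ u p → Constraint1H1 ν T u → ¬ BlowsUpAt T u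

/-- **Step_IV2Abs — p.43 l.1–9 at F15 grain**: «limsup_{t→T*} ‖∇u(t)‖_{L²} = +∞, meaning that for all ε > 0,
there exists δ > 0 such that ‖∇u(t)‖_{L²} > ε whenever T* − δ < t < T*. … Decomposing the dissipation integral
gives ν∫₀^{T*}‖∇u(s)‖²ds ≥ ν∫_{I_δ}‖∇u(s)‖²ds > ν·(2M/ν)·|I_δ| = 2Mδ … contradicting the global boundedness M
in (44)»: a continuous nonnegative `g` on `[0,T)` that is unbounded near `T` has unbounded partial integrals
`∫₀^τ g`, `τ < T`. [claim: PanPan2025, status: disputed] -/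
def Step_IV2Abs : Prop :=
  ∀ T : ℝ, 0 < T → ∀ g : ℝ → ℝ, ContinuousOn g (Ico 0 T) → (∀ t ∈ Ico 0 T, 0 ≤ g t) →
    (∀ K : ℝ, ∃ t ∈ Ico 0 T, K < g t) → ∀ M : ℝ, ∃ τ ∈ Ico 0 T, M < ∫ s in (0:ℝ)..τ, g s

/-- **Step_IV2c — p.43 d4–d5 «For δ > 0, the right-hand side satisfies 2Mδ > M (since |I_δ| = δ > 0)»**, as
printed (the arithmetic closing the contradiction of §4.2.2). [claim: PanPan2025, status: disputed] -/
def Step_IV2c : Prop :=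
  ∀ M δ : ℝ, 0 < M → 0 < δ → M < 2 * M * δ

/-- **Theorem 3.1.2 (Rigidity of the Intrinsic Configuration, p.24) in full**: «If a strong solution exists on
[0,T), then it necessarily satisfies all constraints in Definition 3.1.1» — for every solution of the class,
every `ν > 0`, all parameters `ρ > 0`, `P_max` of Constraint 4 as the print leaves them. Recorded (Constraint 4
is off the strict path by Remark 4.1.2); `Step_C1` is the part the proof consumes. [claim: PanPan2025, status: disputed] -/
def Step_Rigidity : Prop :=
  ∀ ρ Pmax : ℝ, 0 < ρ → 0 < Pmax → ∀ ν : ℝ, 0 < ν → ∀ T : ℝ, 0 < T →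
    ∀ (v₀ : EuclideanSpace ℝ (Fin 3) → EuclideanSpace ℝ (Fin 3))
      (u : ℝ → EuclideanSpace ℝ (Fin 3) → EuclideanSpace ℝ (Fin 3)) (p : ℝ → EuclideanSpace ℝ (Fin 3) → ℝ),
      IsLocalSolution ν T v₀ u p → IntrinsicConfiguration ρ Pmax ν T u p

/-- **Step_C1bK — p.28 l.1–4 under the referee's charitable reading (REF C97 ref-1 g2 2026-08-27T02:37:24Z,
RETYPE.md §2): the Grönwall step WITH the dissipation bound of (16) p.27 in hand** («To apply Gronwall's
inequality, define y(t) := ‖∇u(t)‖²_{L²}, and utilize the kinetic energy estimate … By standard Gronwall's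
inequality (cf. Evans, 2010, Appendix B) …»): for all `a, b, c, K ≥ 0`, `T > 0`, `y₀ ≥ 0` there is `M` such that
every nonnegative `y`, differentiable on `[0,T]` with `y(0) = y₀`, `y′ ≤ a + b y + c y²` on `[0,T]` and
`∫₀ᵀ y ≤ K`, satisfies `y ≤ M` on `[0,T]` — TRUE, `M = (y₀ + aT)e^{bT + cK}` (`step_C1bK_holds`). Companion of
`Step_C1bAbs` (the same sentence read without (16)); neither is consumed by `claim_of_steps`.
[cite: PanPan2025, §3.2.1 p.28 l.1–4 with (16) p.27] -/
def Step_C1bK : Prop :=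
  ∀ a b c K : ℝ, 0 ≤ a → 0 ≤ b → 0 ≤ c → 0 ≤ K → ∀ T : ℝ, 0 < T → ∀ y₀ : ℝ, 0 ≤ y₀ →
    ∃ M : ℝ, ∀ y : ℝ → ℝ, y 0 = y₀ → (∀ t ∈ Icc 0 T, 0 ≤ y t) →
      (∀ t ∈ Icc 0 T, ∃ y' : ℝ, HasDerivAt y y' t ∧ y' ≤ a + b * y t + c * y t ^ 2) →
      (∫ s in (0:ℝ)..T, y s) ≤ K → ∀ t ∈ Icc 0 T, y t ≤ M

/-- **`Step_C1bK` holds**: Grönwall with the integrable coefficient `β = b + c·y` — the function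
`Φ(t) = e^{−∫₀ᵗβ}·y(t) − a t` is non-increasing on `[0,T]` (its derivative is `e^{−∫β}(y′ − βy) − a ≤ 0`), so
`y(t) ≤ e^{∫₀ᵗβ}(y₀ + a t) ≤ (y₀ + aT)e^{bT + cK}` (Gronwall's inequality, differential form, with a
summable coefficient [cite: Evans2010, App. B.2 (j)]). [cite: PanPan2025, §3.2.1 p.28 l.1–4 with (16) p.27] -/
theorem step_C1bK_holds : Step_C1bK := by
  intro a b c K ha hb hc hK T hT y₀ hy₀
  refine ⟨(y₀ + a * T) * Real.exp (b * T + c * K), ?_⟩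
  intro y hy0 hnn hder hint t ht
  -- continuity of `y` and of `β = b + c y` on `[0,T]`
  have hycon : ContinuousOn y (Icc 0 T) := fun s hs => by
    obtain ⟨y', hy', -⟩ := hder s hs
    exact hy'.continuousAt.continuousWithinAt
  set β : ℝ → ℝ := fun s => b + c * y s with hβ
  have hβcon : ContinuousOn β (Icc 0 T) := continuousOn_const.add (continuousOn_const.mul hycon)
  have hβnn : ∀ s ∈ Icc (0:ℝ) T, 0 ≤ β s := fun s hs => by
    have := hnn s hs
    simp only [hβ]
    positivity
  -- the primitive `B(t) = ∫₀ᵗ β`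
  set B : ℝ → ℝ := fun τ => ∫ s in (0:ℝ)..τ, β s with hB
  have hβint : ∀ τ ∈ Icc (0:ℝ) T, IntervalIntegrable β volume 0 τ := fun τ hτ =>
    (hβcon.mono (Icc_subset_Icc_right hτ.2)).intervalIntegrable_of_Icc hτ.1
  have hBcon : ContinuousOn B (Icc 0 T) := by
    have hi : IntegrableOn β (uIcc 0 T) volume := by
      rw [uIcc_of_le hT.le]
      exact hβcon.integrableOn_Icc
    have h := intervalIntegral.continuousOn_primitive_interval hi
    rw [uIcc_of_le hT.le] at h
    exact h
  have hBderiv : ∀ s ∈ Ioo (0:ℝ) T, HasDerivAt B (β s) s := fun s hs =>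
    intervalIntegral.integral_hasDerivAt_right (hβint s ⟨hs.1.le, hs.2.le⟩)
      ((hβcon.mono Ioo_subset_Icc_self).stronglyMeasurableAtFilter isOpen_Ioo s hs)
      (hβcon.continuousAt (Icc_mem_nhds hs.1 hs.2))
  have hBnn : ∀ τ ∈ Icc (0:ℝ) T, 0 ≤ B τ := fun τ hτ =>
    intervalIntegral.integral_nonneg hτ.1 fun s hs => hβnn s ⟨hs.1, hs.2.trans hτ.2⟩
  -- `Φ(t) = e^{−B(t)} y(t) − a t` is non-increasing on `[0,T]`
  set Φ : ℝ → ℝ := fun τ => Real.exp (-B τ) * y τ - a * τ with hΦ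
  have hΦcon : ContinuousOn Φ (Icc 0 T) :=
    (hBcon.neg.rexp.mul hycon).sub (continuousOn_const.mul continuousOn_id)
  have hΦderiv : ∀ s ∈ Ioo (0:ℝ) T, ∃ Φ' : ℝ, HasDerivAt Φ Φ' s ∧ Φ' ≤ 0 := by
    intro s hs
    have hsI : s ∈ Icc (0:ℝ) T := ⟨hs.1.le, hs.2.le⟩
    obtain ⟨y', hy', hle⟩ := hder s hsI
    have hE : HasDerivAt (fun τ => Real.exp (-B τ)) (Real.exp (-B s) * -(β s)) s :=
      (hBderiv s hs).neg.exp
    have hΦ' : HasDerivAt Φ (Real.exp (-B s) * -(β s) * y s + Real.exp (-B s) * y' - a * 1) s :=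
      (hE.mul hy').sub ((hasDerivAt_id s).const_mul a)
    refine ⟨_, hΦ', ?_⟩
    have hexp : Real.exp (-B s) ≤ 1 := by
      rw [Real.exp_le_one_iff]
      linarith [hBnn s hsI]
    have hexp0 : 0 < Real.exp (-B s) := Real.exp_pos _
    have hkey : y' - β s * y s ≤ a := by
      simp only [hβ]
      nlinarith [hle]
    nlinarith [hkey, hexp, hexp0, ha]
  have hΦdiff : DifferentiableOn ℝ Φ (interior (Icc 0 T)) := by
    rw [interior_Icc]
    intro s hs
    obtain ⟨Φ', hΦ', -⟩ := hΦderiv s hs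
    exact hΦ'.differentiableAt.differentiableWithinAt
  have hΦle : ∀ s ∈ interior (Icc (0:ℝ) T), deriv Φ s ≤ 0 := by
    rw [interior_Icc]
    intro s hs
    obtain ⟨Φ', hΦ', hle⟩ := hΦderiv s hs
    rwa [hΦ'.deriv]
  have hanti : AntitoneOn Φ (Icc 0 T) := antitoneOn_of_deriv_nonpos (convex_Icc 0 T) hΦcon hΦdiff hΦle
  have h0 : (0:ℝ) ∈ Icc (0:ℝ) T := ⟨le_rfl, hT.le⟩
  have hΦt : Φ t ≤ Φ 0 := hanti h0 ht ht.1
  have hΦ0 : Φ 0 = y₀ := by simp [hΦ, hB, hy0]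
  -- unwind: `y t ≤ e^{B t}(y₀ + a t)`
  have hBt : B t ≤ b * T + c * K := by
    have hyint : ∀ τ ∈ Icc (0:ℝ) T, IntervalIntegrable y volume 0 τ := fun τ hτ =>
      (hycon.mono (Icc_subset_Icc_right hτ.2)).intervalIntegrable_of_Icc hτ.1
    have hsplit : B t = b * t + c * ∫ s in (0:ℝ)..t, y s := by
      simp only [hB, hβ]
      rw [intervalIntegral.integral_add intervalIntegrable_const ((hyint t ht).const_mul c),
        intervalIntegral.integral_const, intervalIntegral.integral_const_mul, smul_eq_mul, sub_zero, mul_comm]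
    have hmono : ∫ s in (0:ℝ)..t, y s ≤ ∫ s in (0:ℝ)..T, y s := by
      have htT : IntervalIntegrable y volume t T :=
        (hycon.mono (Icc_subset_Icc_left ht.1)).intervalIntegrable_of_Icc ht.2
      rw [← intervalIntegral.integral_add_adjacent_intervals (hyint t ht) htT]
      have : 0 ≤ ∫ s in t..T, y s :=
        intervalIntegral.integral_nonneg ht.2 fun s hs => hnn s ⟨ht.1.trans hs.1, hs.2⟩
      linarith
    rw [hsplit]
    have h1 : b * t ≤ b * T := mul_le_mul_of_nonneg_left ht.2 hb
    have h2 : c * ∫ s in (0:ℝ)..t, y s ≤ c * K := mul_le_mul_of_nonneg_left (hmono.trans hint) hc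
    linarith
  have hyt : y t ≤ Real.exp (B t) * (y₀ + a * t) := by
    have h1 : Real.exp (-B t) * y t ≤ y₀ + a * t := by
      have := hΦt
      simp only [hΦ] at this
      linarith [hΦ0.symm.le, hΦ0.le]
    have h2 := mul_le_mul_of_nonneg_left h1 (Real.exp_pos (B t)).le
    rwa [← mul_assoc, ← Real.exp_add, add_neg_cancel, Real.exp_zero, one_mul] at h2
  calc y t ≤ Real.exp (B t) * (y₀ + a * t) := hyt
    _ ≤ Real.exp (b * T + c * K) * (y₀ + a * T) := by
        apply mul_le_mul (Real.exp_le_exp.mpr hBt) (by nlinarith [ht.2]) (by nlinarith [ht.1])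
          (Real.exp_pos _).le
    _ = (y₀ + a * T) * Real.exp (b * T + c * K) := mul_comm _ _

/-! ### Kernel composition (the paper's own implication chain; PROVED) -/

/-- **Theorem 3.1.4 (ii)⟹(i) with Theorem 3.1.2 and Ch. Ⅳ, as the paper composes them** (p.25: «By the local
existence theorem (Kato, 1972), the solution extends to some maximal time T* > 0. The global boundedness
provided by the intrinsic configuration prevents blowup at T*, implying the solution exists for all t > 0»):
Step 1 gives a global solution or a finite `T*` with blow-up; Step_C1 gives the `H¹` bound on `[0,T*)`; Step_IV
excludes the blow-up. [cite: PanPan2025, proof of Thm 3.1.4 p.25; Ch. Ⅳ pp.37–43] -/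
theorem claim_of_steps (h1 : Step_1) (hC1 : Step_C1) (hIV : Step_IV) : ClaimedTheorem := by
  intro ν hν v₀ hv₀
  rcases h1 ν hν.le v₀ hv₀ with hglob | ⟨T, hT, u, p, hsol, hblow⟩
  · exact hglob
  · exact absurd hblow (hIV ν hν T hT v₀ u p hsol (hC1 ν hν T hT v₀ u p hsol))

/-! ### Clay link -/

/-- **The claim implies Clay (A)** (`ClayVariants.clayR3.Regularity`): the headline is C28b's `ClaimedGlobalNS`
token for token, whose Clay link is PROVED in the tree (`Iotti2025.clay_of_claimedGlobalNS`: Clay data are data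
of the class; the global solution of the class is smooth on `ℝ³ × [0,∞)` with bounded energy by
`bkm_energy_le`). [cite: FeffermanClay2006, statement (A), CMI offprint p. 2] -/
theorem clay_of_claimed (h : ClaimedTheorem) : ClayVariants.clayR3.Regularity :=
  Iotti2025.clay_of_claimedGlobalNS (claimedTheorem_iff_C28b.mp h)

/-! #### Discharge of Step 1 (D-0026; the tree's BKM-class maximal-solution theorem) -/

/-- **Step 1 holds** (the local well-posedness input of §3, = C28b's Step 1 = `Chae2007.Step_1` by
definition): now a tree theorem (`Chae2007.step_1_holds`, assembled from the discharged Majda–Bertozzi 2002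
local existence / uniqueness / Cor. 3.2 / BKM facts via
`Literature.Analysis.FluidPDE.exists_global_bkmClass_or_blowup`). Upstream of C97's locator; nothing above is
touched. [cite: PanPan2025, Thm 2.1 p.16; proof of Thm 3.1.4 p.25] -/
theorem step1_holds : Step_1 :=
  Chae2007.step_1_holds

/-! ## Discharge of Step_IV (D-0026 debt pass, ns-claims-typist-10 g5, 2026-08-27; APPEND-ONLY — no statement,
definition, locator or class above is touched; C97's token and the erratum kernels of record are unaffected).
Ch. Ⅳ §4.2 AS AN IMPLICATION is the classical `H¹` continuation principle: a regular solution on `[0,T)` whose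
velocity gradient stays bounded in `L²` (Constraint 1 (21)) continues in the Beale–Kato–Majda class, so its
`H³` norm is bounded on `[0,T)`. Inputs, all tree theorems: Tao's energy bound on closed slabs
(`tao_finite_energy_smooth_energy_bound_holds`), the `H¹` continuation theorem
`hasSobolevExtensionPast_of_uniform_H1_bound` (`H1ContinuationSobolevClass`), and the identification
`∫⁻ |∇u(t)|²_F = ofReal (gradNormSq (u t))` in the class. -/

/-- **Step_IV holds** (Ch. Ⅳ §4.2 pp.40–43 read as the implication «Constraint 1 ⇒ no blow-up at `T`»):
for `ν > 0`, a solution of the class on `[0,T)` obeying the uniform `H¹` bound (21) does not blow up at `T`.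
Proof: Tao's energy bound on every `[0,T″]`, `T″ < T`, gives `∫|u(t)|² ≤ C_e∫|u₀|²`; (21) gives
`∫|∇u(t)|²_F ≤ C` (the dissipation integral is nonnegative); `hasSobolevExtensionPast_of_uniform_H1_bound`
continues `u` in the class past `T` with all Sobolev norms bounded on `[0,T]`, whence `¬ BlowsUpAt T u`.
The PRINTED route (`Step_IV2Abs` + `Step_IV2c`) is not used. [cite: PanPan2025, Ch. Ⅳ §4.2 pp.40–43]
[cite: Tao2011, Lemma 8.1] -/
theorem step_IV_holds : Step_IV := by
  intro ν hν T hT v₀ u p hsol hC1 hblow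
  have hS0 : IsClassicalNSSolutionOn (Ico 0 T) ν 0 u p := hsol.isClassical
  have hreg : ∀ T'' < T, HasBoundedSobolevNormsOn (Icc 0 T'') u := hsol.sobolev
  obtain ⟨C, hC⟩ := hC1
  -- the uniform `H¹` quantity: energy via Tao's bound, gradient via Constraint 1
  obtain ⟨Ce, hCetop, hTao⟩ := tao_finite_energy_smooth_energy_bound_holds
  have hreg0 : HasBoundedSobolevNormsOn (Icc 0 (T / 2)) u := hreg (T / 2) (by linarith)
  have h00 : (0 : ℝ) ∈ Icc 0 (T / 2) := ⟨le_rfl, by linarith⟩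
  set E₀ : ℝ≥0∞ := ∫⁻ x, ‖u 0 x‖ₑ ^ 2 with hE₀
  have hE₀top : E₀ < ⊤ := by
    obtain ⟨C0, hC0'⟩ := hreg0 0
    refine lt_of_le_of_lt (le_of_eq (lintegral_congr fun x => ?_)) ((hC0' 0 h00).trans_lt ENNReal.coe_lt_top)
    rw [← ofReal_norm, ← ofReal_norm, norm_iteratedFDeriv_zero]
  have hCE : Ce * E₀ < ⊤ := ENNReal.mul_lt_top hCetop hE₀top
  set Ē : ℝ := (Ce * E₀).toReal with hĒ
  have hĒ0 : 0 ≤ Ē := ENNReal.toReal_nonneg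
  have hA : ∀ t ∈ Ico 0 T,
      (∫⁻ x, ‖u t x‖ₑ ^ 2) + (∫⁻ x, ENNReal.ofReal (frobeniusNormSq (fderiv ℝ (u t) x))) ≤
        ENNReal.ofReal (Ē + max C 0) := by
    intro t ht
    -- a closed slab containing `t`
    set T'' : ℝ := (t + T) / 2 with hT''def
    have htT'' : t < T'' := by rw [hT''def]; linarith [ht.2]
    have hT''T : T'' < T := by rw [hT''def]; linarith [ht.2]
    have hT''pos : 0 < T'' := lt_of_le_of_lt ht.1 htT''
    have hS : IsClassicalNSSolutionOn (Icc 0 T'') ν 0 u p :=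
      hS0.mono (Icc_subset_Ico_right hT''T) (uniqueDiffOn_Icc hT''pos)
    have hB : HasBoundedSobolevNormsOn (Icc 0 T'') u := hreg T'' hT''T
    have htS : t ∈ Icc 0 T'' := ⟨ht.1, htT''.le⟩
    -- energy
    have hfe : ∃ A : ℝ≥0∞, A < ⊤ ∧ ∀ s ∈ Icc 0 T'', ∫⁻ x, ‖u s x‖ₑ ^ 2 ≤ A := by
      obtain ⟨C0, hC0'⟩ := hB 0
      refine ⟨C0, ENNReal.coe_lt_top, fun s hs => ?_⟩
      refine le_trans (le_of_eq (lintegral_congr fun x => ?_)) (hC0' s hs)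
      rw [← ofReal_norm, ← ofReal_norm, norm_iteratedFDeriv_zero]
    obtain ⟨hen, -⟩ := hTao ν T'' hν hT''pos u p hS hfe
    have hen' : ∫⁻ x, ‖u t x‖ₑ ^ 2 ≤ ENNReal.ofReal Ē := by
      rw [hĒ, ENNReal.ofReal_toReal hCE.ne]
      exact hen t htS
    -- gradient: `∫⁻ |∇u(t)|²_F = ofReal (gradNormSq (u t)) ≤ ofReal C`
    have hsm : ContDiff ℝ ∞ (u t) := hS.contDiff_velocity htS
    have hcont : Continuous fun x => frobeniusNormSq (fderiv ℝ (u t) x) :=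
      continuous_frobeniusNormSq_fderiv hsm (by simp)
    have hnn : 0 ≤ᵐ[volume] fun x => frobeniusNormSq (fderiv ℝ (u t) x) :=
      Eventually.of_forall fun x => frobeniusNormSq_nonneg _
    have hfin1 : ∫⁻ x, ‖iteratedFDeriv ℝ 1 (u t) x‖ₑ ^ 2 < ⊤ := by
      obtain ⟨C1, hC1'⟩ := hB 1
      exact (hC1' t htS).trans_lt ENNReal.coe_lt_top
    have hlt : ∫⁻ x, ENNReal.ofReal (frobeniusNormSq (fderiv ℝ (u t) x)) < ⊤ :=
      lt_of_le_of_lt (lintegral_frobeniusNormSq_le_three_mul (u t))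
        (ENNReal.mul_lt_top (by simp) hfin1)
    have hint : Integrable fun x => frobeniusNormSq (fderiv ℝ (u t) x) :=
      ⟨hcont.aestronglyMeasurable, (hasFiniteIntegral_iff_ofReal hnn).2 hlt⟩
    have hgrad_eq : ∫⁻ x, ENNReal.ofReal (frobeniusNormSq (fderiv ℝ (u t) x)) =
        ENNReal.ofReal (VectorCalculus.gradNormSq (u t)) := by
      rw [VectorCalculus.gradNormSq, ofReal_integral_eq_lintegral_ofReal hint hnn]
    have hdiss : 0 ≤ ∫ s in (0:ℝ)..t, l2Sq (fun x => Δ (u s) x) :=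
      intervalIntegral.integral_nonneg ht.1 fun s _ => integral_nonneg fun x => sq_nonneg _
    have hgradC : VectorCalculus.gradNormSq (u t) ≤ max C 0 := by
      have h := hC t ht
      have hν' : 0 ≤ ν * ∫ s in (0:ℝ)..t, l2Sq (fun x => Δ (u s) x) := mul_nonneg hν.le hdiss
      exact le_trans (by linarith) (le_max_left C 0)
    have hdc : ∫⁻ x, ENNReal.ofReal (frobeniusNormSq (fderiv ℝ (u t) x)) ≤ ENNReal.ofReal (max C 0) := by
      rw [hgrad_eq]
      exact ENNReal.ofReal_le_ofReal hgradC
    calc (∫⁻ x, ‖u t x‖ₑ ^ 2) + (∫⁻ x, ENNReal.ofReal (frobeniusNormSq (fderiv ℝ (u t) x)))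
        ≤ ENNReal.ofReal Ē + ENNReal.ofReal (max C 0) := add_le_add hen' hdc
      _ = ENNReal.ofReal (Ē + max C 0) := (ENNReal.ofReal_add hĒ0 (le_max_right C 0)).symm
  -- continuation in the class past `T`, hence the class bounds on `[0,T)`
  obtain ⟨T', -, U, P, -, hUB, hUeq⟩ :=
    hasSobolevExtensionPast_of_uniform_H1_bound hν hT hS0 hreg (by positivity) hA
  have hBT : HasBoundedSobolevNormsOn (Ico 0 T) u := fun n => by
    obtain ⟨Cn, hCn⟩ := hUB n
    exact ⟨Cn, fun t ht => by rw [← hUeq t ht]; exact hCn t (Ico_subset_Icc_self ht)⟩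
  choose D hD using hBT
  refine hblow ⟨∑ n ∈ Finset.range 4, D n, fun t ht => ?_⟩
  push_cast
  exact Finset.sum_le_sum fun n _ => hD n t ht

/-- `Step_IV` — `_holds` alias of `step_IV_holds` above under the fact's exact name (appended
2026-08-28, D-0026 bookkeeping: the proof term is the existing theorem of this file; no statement,
definition or attribute is edited; no new named fact; the ledger's debt table listed the fact
unproved). [cite: Tao2011, Lemma 8.1] -/
theorem _root_.Literature.Claims.NS.PanPan2025.Step_IV_holds : Step_IV :=
  _root_.Literature.Claims.NS.PanPan2025.step_IV_holds

end Literature.Claims.NS.PanPan2025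

end
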